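import Literature.NumberTheory.Transcendental.RoyRankGenericRational
import HarnessLib

/-!
# Roy 1992 over a general field: Propositions 1–3 and Theorem 1bis for Roy's category `𝒞`

Theorem-only support file (no definitions, no facts) for the field-generic deduction
`RoyRank.Thm1 F L ω → RoyRank.Thm2 F L ω` ([Roy1992] §§2–3) over the data of
`Literature.NumberTheory.Transcendental.RoyRankGenericDefs`, continuing `…RoyRankGenericCategory`
and `…RoyRankGenericRational`; field-generic form of the second part of the tree's `K = ℂ`
companion `Literature.Barriers.Schanuel.AlgebraicIndependenceOfLogarithmsRoyKernels` (whose
field-generic lemmas `Roy1992.exists_injective_range_eq_spanK`, `range_mulVecLin_map`,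
`finrank_map_add_finrank_comap`, `exists_surjective_ker_eq_spanK`, … are reused by import):

* **Proposition 1** ("Any kernel of `𝒞` admits a cokernel in `𝒞` and, vice versa, any cokernel of
  `𝒞` admits a kernel in `𝒞`."): `Obj.prop1_ker`, `Obj.prop1_coker` — the two arguments of
  `RoyRank.royCat`, giving Roy's admissible category `royCat prop1_ker prop1_coker`;
* **Proposition 2** ("The function `a` is upper additive while `b, c, d, r, d₀`, and `d₁` are
  additive. These functions vanish on each object on which `r` vanishes."), from the exact
  sequences of p. 28 (`Obj.dims_of_exact`, `finrank_VW_of_exact`, `finrank_Y_of_exact`,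
  `finrank_Y_inf_omega_of_exact`), packaged as `Obj.thm3Hyp` and `Obj.fd₁_additive`;
* **Proposition 3** ("For each object `X` of `𝒞`, there exists a cokernel `s : X → X'` with domain
  `X` such that `d₁(X') ≤ a(X)` and `b(X') = b(X)`."), `Obj.prop3` — `s = id × t₁` with `t₁` a
  rational surjection of kernel `K·(V ∩ (0 × ℚ^{d₁}))` (pp. 28–29); for `ω = 0` (`Ω = 0`, the
  `p`-adic case) the bound `dim_ℚ(Y ∩ Ω) ≤ dim S₁` is trivial, for `ω ≠ 0` it is Roy's;
* **Theorem 1bis** (`Obj.statement1_of_thm1`: `Thm1 F L ω` is Statement 1 of Roy's Theorem 3 for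
  `(𝒞, a, b, c, d, r)`).

## References

* [Roy1992] D. Roy, *Matrices whose coefficients are linear forms in logarithms*, J. Number Theory
  41 (1992) 22–47: §2 Propositions 1–3, Theorem 1bis and their proofs (pp. 26–29); §3 (p. 32).
-/

noncomputable section

open Module Submodule
open Literature.Barriers.Schanuel.Roy1992 (AdmissibleCat incl incl_apply spanK finrank_spanK
  exists_surjective_ker_eq_spanK ker_mulVecLin_map exists_injective_range_eq_spanK
  range_mulVecLin_map finrank_map_add_finrank_comap finrank_map_add_finrank_ker finrank_prod_eq)

namespace Literature.NumberTheory.Transcendental.RoyRank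

variable {K : Type*} [Field K] [CharZero K]
variable {F : IntermediateField ℚ K} {L : Submodule ℚ K} {ω : K}
variable {d₀ d₁ d₀' d₁' a₀ a₁ : ℕ}

/-! ### Proposition 1: kernels have cokernels and cokernels have kernels -/

namespace Obj

/-- **Proposition 1, first half**: every kernel `(X*, X, i)` admits a cokernel `(X, X', s)` with
`Im(i) = ker(s)` (`Im(i) = S₀ × S₁` with `S₀` rational over `F`, `S₁` rational over `ℚ`; take
`s = t₀ × t₁` with rational surjections `t₀, t₁` of kernels `S₀, S₁`).
[cite: Roy1992, §2 Proposition 1 (p. 27)] -/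
theorem prop1_ker (A X : Obj F L) (i : LinTangent K A.d₀ A.d₁ →ₗ[K] LinTangent K X.d₀ X.d₁)
    (hi : A.IsKerMap X i) :
    ∃ (B : Obj F L) (s : LinTangent K X.d₀ X.d₁ →ₗ[K] LinTangent K B.d₀ B.d₁),
      X.IsCokerMap B s ∧ LinearMap.range i = LinearMap.ker s := by
  obtain ⟨-, hbi, -, -, -⟩ := hi
  obtain ⟨B₀, B₁, hdec⟩ := exists_eq_prodMap_of_isBiRational hbi
  obtain ⟨e₀, T₀, -, hsurj₀, hker₀⟩ := exists_surjective_ker_eq_spanK (F := F) (K := K)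
    (LinearMap.range B₀.mulVecLin)
  obtain ⟨e₁, T₁, -, hsurj₁, hker₁⟩ := exists_surjective_ker_eq_spanK (F := ℚ) (K := K)
    (LinearMap.range B₁.mulVecLin)
  have hbr : IsBiRational F ((T₀.map (algebraMap F K)).mulVecLin.prodMap
      (T₁.map (algebraMap ℚ K)).mulVecLin) := isBiRational_prodMap T₀ T₁
  have hs : IsAdmissible F ((T₀.map (algebraMap F K)).mulVecLin.prodMap
      (T₁.map (algebraMap ℚ K)).mulVecLin) := by
    refine ⟨?_, hbr⟩
    rw [LinearMap.coe_prodMap]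
    exact hsurj₀.prodMap hsurj₁
  have hker : LinearMap.range i = LinearMap.ker ((T₀.map (algebraMap F K)).mulVecLin.prodMap
      (T₁.map (algebraMap ℚ K)).mulVecLin) := by
    rw [hdec, LinearMap.range_prodMap, LinearMap.ker_prodMap, hker₀, hker₁, range_mulVecLin_map,
      range_mulVecLin_map]
  exact ⟨X.mapObj _ hbr, _, X.isCokerMap_mapObj hs, hker⟩

/-- **Proposition 1, second half**: every cokernel `(X, X', s)` admits a kernel `(X*, X, i)` with
`Im(i) = ker(s)` (`ker(s) = S₀ × S₁` with `S₀, S₁` rational; take `i = i₀ × i₁` with rational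
injections onto `S₀, S₁` and `X* = (K^{a₀} × K^{a₁}, i⁻¹(Y), i⁻¹(W), i⁻¹(V))` the preimage object).
[cite: Roy1992, §2 Proposition 1 (p. 27)] -/
theorem prop1_coker (X B : Obj F L) (s : LinTangent K X.d₀ X.d₁ →ₗ[K] LinTangent K B.d₀ B.d₁)
    (hs : X.IsCokerMap B s) :
    ∃ (A : Obj F L) (i : LinTangent K A.d₀ A.d₁ →ₗ[K] LinTangent K X.d₀ X.d₁),
      A.IsKerMap X i ∧ LinearMap.range i = LinearMap.ker s := by
  obtain ⟨⟨-, hbi⟩, -, -, -⟩ := hs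
  obtain ⟨A₀, A₁, hdec⟩ := exists_eq_prodMap_of_isBiRational hbi
  obtain ⟨a₀, B₀, -, hinj₀, hrange₀⟩ := exists_injective_range_eq_spanK (F := F) (K := K)
    (LinearMap.ker A₀.mulVecLin)
  obtain ⟨a₁, B₁, -, hinj₁, hrange₁⟩ := exists_injective_range_eq_spanK (F := ℚ) (K := K)
    (LinearMap.ker A₁.mulVecLin)
  set i : LinTangent K a₀ a₁ →ₗ[K] LinTangent K X.d₀ X.d₁ :=
    (B₀.map (algebraMap F K)).mulVecLin.prodMap (B₁.map (algebraMap ℚ K)).mulVecLin with hi_def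
  have hinj : Function.Injective i := by
    rw [hi_def, LinearMap.coe_prodMap]
    exact hinj₀.prodMap hinj₁
  have hbi' : IsBiRational F i := isBiRational_prodMap B₀ B₁
  have hrange : LinearMap.range i = LinearMap.ker s := by
    rw [hdec, LinearMap.ker_prodMap, hi_def, LinearMap.range_prodMap, hrange₀, hrange₁,
      ker_mulVecLin_map, ker_mulVecLin_map]
  haveI := X.finite
  let A : Obj F L :=
    { d₀ := a₀
      d₁ := a₁
      Y := X.Y.comap (i.restrictScalars ℚ)
      W := X.W.comap i
      V := X.V.comap i
      finite := by
        refine Module.Finite.of_injective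
          ((i.restrictScalars ℚ).restrict (p := X.Y.comap (i.restrictScalars ℚ)) (q := X.Y)
            fun x hx => hx) ?_
        intro x y hxy
        apply Subtype.ext
        apply hinj
        have := congrArg Subtype.val hxy
        simpa using this
      isLog := hbi'.isFLogSubspace_comap hinj X.isLog
      isRat := hbi'.isFRational_comap hinj X.isRat
      hYV := fun _ hy => X.hYV hy
      hWV := Submodule.comap_mono X.hWV }
  exact ⟨A, i, ⟨hinj, hbi', rfl, rfl, rfl⟩, hrange⟩

end Obj

-- Roy's category `𝒞` over `(K, F, L)`, made admissible by Proposition 1 (local notation).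
local notation "𝒞" => royCat (F := F) (L := L) Obj.prop1_ker Obj.prop1_coker

/-! ### Exact triples of `𝒞`: the dimensions -/

omit [CharZero K] in
/-- Exactness is preserved by restricting scalars to `ℚ`. [folklore] -/
theorem range_restrictScalars_eq_ker [Algebra ℚ K] {i : LinTangent K a₀ a₁ →ₗ[K] LinTangent K d₀ d₁}
    {s : LinTangent K d₀ d₁ →ₗ[K] LinTangent K d₀' d₁'} (hex : LinearMap.range i = LinearMap.ker s) :
    LinearMap.range (i.restrictScalars ℚ) = LinearMap.ker (s.restrictScalars ℚ) := by
  ext x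
  rw [LinearMap.mem_ker, LinearMap.restrictScalars_apply, ← LinearMap.mem_ker, ← hex,
    LinearMap.mem_range, LinearMap.mem_range]
  rfl

namespace Obj

/-- Along an exact triple `(X*, X, X')` the dimensions add: `d₀ = d₀* + d₀'`, `d₁ = d₁* + d₁'`
(blockwise rank–nullity). [cite: Roy1992, §2 Proposition 2 (p. 28)] -/
theorem dims_of_exact {A X B : Obj F L} {i : LinTangent K A.d₀ A.d₁ →ₗ[K] LinTangent K X.d₀ X.d₁}
    {s : LinTangent K X.d₀ X.d₁ →ₗ[K] LinTangent K B.d₀ B.d₁} (hi : A.IsKerMap X i)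
    (hs : X.IsCokerMap B s) (hex : LinearMap.range i = LinearMap.ker s) :
    A.d₀ + B.d₀ = X.d₀ ∧ A.d₁ + B.d₁ = X.d₁ := by
  obtain ⟨hinj, hbi, -, -, -⟩ := hi
  obtain ⟨⟨hsurj, hbs⟩, -, -, -⟩ := hs
  obtain ⟨B₀, B₁, hdi⟩ := exists_eq_prodMap_of_isBiRational hbi
  obtain ⟨A₀, A₁, hds⟩ := exists_eq_prodMap_of_isBiRational hbs
  rw [hdi, hds, LinearMap.range_prodMap, LinearMap.ker_prodMap] at hex
  have hex₀ := congrArg (Submodule.map (LinearMap.fst K _ _)) hex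
  rw [Submodule.prod_map_fst, Submodule.prod_map_fst] at hex₀
  have hex₁ := congrArg (Submodule.map (LinearMap.snd K _ _)) hex
  rw [Submodule.prod_map_snd, Submodule.prod_map_snd] at hex₁
  have hinj₀ : Function.Injective (B₀.map (algebraMap F K)).mulVecLin := by
    intro z z' hzz'
    have : i (z, 0) = i (z', 0) := by
      rw [hdi, LinearMap.prodMap_apply, LinearMap.prodMap_apply, hzz']
    exact congrArg Prod.fst (hinj this)
  have hinj₁ : Function.Injective (B₁.map (algebraMap ℚ K)).mulVecLin := by
    intro z z' hzz'
    have : i (0, z) = i (0, z') := by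
      rw [hdi, LinearMap.prodMap_apply, LinearMap.prodMap_apply, hzz']
    exact congrArg Prod.snd (hinj this)
  have hsurj₀ : Function.Surjective (A₀.map (algebraMap F K)).mulVecLin := by
    intro z
    obtain ⟨⟨x, y⟩, h⟩ := hsurj (z, 0)
    refine ⟨x, ?_⟩
    rw [hds, LinearMap.prodMap_apply] at h
    exact congrArg Prod.fst h
  have hsurj₁ : Function.Surjective (A₁.map (algebraMap ℚ K)).mulVecLin := by
    intro z
    obtain ⟨⟨x, y⟩, h⟩ := hsurj (0, z)
    refine ⟨y, ?_⟩
    rw [hds, LinearMap.prodMap_apply] at h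
    exact congrArg Prod.snd h
  have r₀ := LinearMap.finrank_range_add_finrank_ker (A₀.map (algebraMap F K)).mulVecLin
  rw [LinearMap.range_eq_top.2 hsurj₀, finrank_top, ← hex₀,
    LinearMap.finrank_range_of_inj hinj₀] at r₀
  have r₁ := LinearMap.finrank_range_add_finrank_ker (A₁.map (algebraMap ℚ K)).mulVecLin
  rw [LinearMap.range_eq_top.2 hsurj₁, finrank_top, ← hex₁,
    LinearMap.finrank_range_of_inj hinj₁] at r₁
  simp only [finrank_fin_fun] at r₀ r₁
  omega

/-- Along an exact triple, `dim V = dim V* + dim V'` and `dim W = dim W* + dim W'`.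
[cite: Roy1992, §2 proof of Proposition 2 (p. 28)] -/
theorem finrank_VW_of_exact {A X B : Obj F L} {i : LinTangent K A.d₀ A.d₁ →ₗ[K] LinTangent K X.d₀ X.d₁}
    {s : LinTangent K X.d₀ X.d₁ →ₗ[K] LinTangent K B.d₀ B.d₁} (hi : A.IsKerMap X i)
    (hs : X.IsCokerMap B s) (hex : LinearMap.range i = LinearMap.ker s) :
    finrank K B.V + finrank K A.V = finrank K X.V ∧
      finrank K B.W + finrank K A.W = finrank K X.W := by
  obtain ⟨hinj, -, -, hW, hV⟩ := hi
  obtain ⟨-, -, hW', hV'⟩ := hs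
  rw [hV, hW, hV', hW']
  exact ⟨finrank_map_add_finrank_comap i s hinj hex X.V,
    finrank_map_add_finrank_comap i s hinj hex X.W⟩

/-- Along an exact triple, `dim_ℚ Y = dim_ℚ Y* + dim_ℚ Y'`. [cite: Roy1992, §2 proof of Proposition 2 (p. 28)] -/
theorem finrank_Y_of_exact {A X B : Obj F L} {i : LinTangent K A.d₀ A.d₁ →ₗ[K] LinTangent K X.d₀ X.d₁}
    {s : LinTangent K X.d₀ X.d₁ →ₗ[K] LinTangent K B.d₀ B.d₁} (hi : A.IsKerMap X i)
    (hs : X.IsCokerMap B s) (hex : LinearMap.range i = LinearMap.ker s) :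
    finrank ℚ B.Y + finrank ℚ A.Y = finrank ℚ X.Y := by
  obtain ⟨hinj, -, hY, -, -⟩ := hi
  obtain ⟨-, hY', -, -⟩ := hs
  rw [hY, hY']
  exact finrank_map_add_finrank_comap (i.restrictScalars ℚ) (s.restrictScalars ℚ) hinj
    (range_restrictScalars_eq_ker hex) X.Y

/-- Along an exact triple, `dim_ℚ(Y ∩ Ω) ≤ dim_ℚ(Y* ∩ Ω*) + dim_ℚ(Y' ∩ Ω')` ("the function
`d₁ − a` is lower additive"). [cite: Roy1992, §2 proof of Proposition 2 (p. 28)] -/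
theorem finrank_Y_inf_omega_of_exact (ω : K) {A X B : Obj F L}
    {i : LinTangent K A.d₀ A.d₁ →ₗ[K] LinTangent K X.d₀ X.d₁}
    {s : LinTangent K X.d₀ X.d₁ →ₗ[K] LinTangent K B.d₀ B.d₁} (hi : A.IsKerMap X i)
    (hs : X.IsCokerMap B s) (hex : LinearMap.range i = LinearMap.ker s) :
    finrank ℚ ↥(X.Y ⊓ Omega ω X.d₀ X.d₁) ≤
      finrank ℚ ↥(A.Y ⊓ Omega ω A.d₀ A.d₁) + finrank ℚ ↥(B.Y ⊓ Omega ω B.d₀ B.d₁) := by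
  obtain ⟨hinj, hbi, hY, -, -⟩ := hi
  obtain ⟨⟨-, hbs⟩, hY', -, -⟩ := hs
  set T := X.Y ⊓ Omega ω X.d₀ X.d₁
  haveI : Module.Finite ℚ T :=
    Module.Finite.of_injective (Submodule.inclusion inf_le_left) (Submodule.inclusion_injective _)
  have h := finrank_map_add_finrank_comap (i.restrictScalars ℚ) (s.restrictScalars ℚ) hinj
    (range_restrictScalars_eq_ker hex) T
  have h1 : T.map (s.restrictScalars ℚ) ≤ B.Y ⊓ Omega ω B.d₀ B.d₁ := by
    rw [hY']
    exact le_inf (Submodule.map_mono inf_le_left)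
      ((Submodule.map_mono inf_le_right).trans (IsBiRational.map_omega_le hbs))
  have h2 : T.comap (i.restrictScalars ℚ) ≤ A.Y ⊓ Omega ω A.d₀ A.d₁ := by
    rw [hY]
    exact le_inf (Submodule.comap_mono inf_le_left)
      ((Submodule.comap_mono inf_le_right).trans (hbi.comap_omega_le hinj))
  haveI : Module.Finite ℚ ↥(B.Y ⊓ Omega ω B.d₀ B.d₁) :=
    Module.Finite.of_injective (Submodule.inclusion inf_le_left) (Submodule.inclusion_injective _)
  haveI : Module.Finite ℚ ↥(A.Y ⊓ Omega ω A.d₀ A.d₁) :=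
    Module.Finite.of_injective (Submodule.inclusion inf_le_left) (Submodule.inclusion_injective _)
  have h1' := LinearMap.finrank_le_finrank_of_injective (Submodule.inclusion_injective h1)
  have h2' := LinearMap.finrank_le_finrank_of_injective (Submodule.inclusion_injective h2)
  omega

/-! ### Proposition 2 -/

/-- `r = d₀ + d₁` is additive. [cite: Roy1992, §2 Proposition 2 (p. 28)] -/
theorem fr_additive : (𝒞).Additive (fr : Obj F L → ℕ) := by
  rintro A X B ⟨i, s, hi, hs, hex⟩
  have := dims_of_exact hi hs hex
  unfold fr
  omega

/-- `d₀` is additive. [cite: Roy1992, §2 Proposition 2 (p. 28)] -/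
theorem fd₀_additive : (𝒞).Additive (fd₀ : Obj F L → ℕ) := by
  rintro A X B ⟨i, s, hi, hs, hex⟩
  have := dims_of_exact hi hs hex
  unfold fd₀
  omega

/-- `d₁` is additive. [cite: Roy1992, §2 Proposition 2 (p. 28)] -/
theorem fd₁_additive : (𝒞).Additive (fd₁ : Obj F L → ℕ) := by
  rintro A X B ⟨i, s, hi, hs, hex⟩
  have := dims_of_exact hi hs hex
  unfold fd₁
  omega

/-- `b = d₀ + d₁ − dim V` is additive. [cite: Roy1992, §2 Proposition 2 (p. 28)] -/
theorem fb_additive : (𝒞).Additive (fb : Obj F L → ℕ) := by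
  rintro A X B ⟨i, s, hi, hs, hex⟩
  have h1 := dims_of_exact hi hs hex
  have h2 := (finrank_VW_of_exact hi hs hex).1
  have h3 := A.finrank_V_le
  have h4 := B.finrank_V_le
  unfold fb
  omega

/-- `c = dim_ℚ Y` is additive. [cite: Roy1992, §2 Proposition 2 (p. 28)] -/
theorem fc_additive : (𝒞).Additive (fc : Obj F L → ℕ) := by
  rintro A X B ⟨i, s, hi, hs, hex⟩
  have := finrank_Y_of_exact hi hs hex
  unfold fc
  omega

/-- `d = dim V − dim W` is additive. [cite: Roy1992, §2 Proposition 2 (p. 28)] -/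
theorem fd_additive : (𝒞).Additive (fd : Obj F L → ℕ) := by
  rintro A X B ⟨i, s, hi, hs, hex⟩
  have h1 := finrank_VW_of_exact hi hs hex
  have h3 := A.finrank_W_le
  have h4 := B.finrank_W_le
  have h5 := X.finrank_W_le
  unfold fd
  omega

/-- `a = d₁ − dim_ℚ(Y ∩ Ω)` is upper additive. [cite: Roy1992, §2 Proposition 2 (p. 28)] -/
theorem fa_upperAdditive (ω : K) : (𝒞).UpperAdditive (fa ω : Obj F L → ℕ) := by
  rintro A X B ⟨i, s, hi, hs, hex⟩
  have h1 := dims_of_exact hi hs hex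
  have h2 := finrank_Y_inf_omega_of_exact ω hi hs hex
  have h3 := A.finrank_Y_inf_omega_le ω
  have h4 := B.finrank_Y_inf_omega_le ω
  have h5 := X.finrank_Y_inf_omega_le ω
  unfold fa
  omega

/-- `a, b, c, d` vanish where `r` vanishes (`d₀ = d₁ = 0`: the ambient space is zero).
[cite: Roy1992, §2 Proposition 2 (p. 28)] -/
theorem vanish (ω : K) (X : Obj F L) (hr : fr X = 0) :
    fa ω X = 0 ∧ fb X = 0 ∧ fc X = 0 ∧ fd X = 0 := by
  have hd₀ : X.d₀ = 0 := by unfold fr at hr; omega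
  have hd₁ : X.d₁ = 0 := by unfold fr at hr; omega
  have h0 : ∀ v : LinTangent K X.d₀ X.d₁, v = 0 := fun v =>
    Prod.ext (funext fun k => (Fin.cast hd₀ k).elim0) (funext fun k => (Fin.cast hd₁ k).elim0)
  have hY : X.Y = ⊥ := (Submodule.eq_bot_iff _).2 fun v _ => h0 v
  have hV : X.V = ⊥ := (Submodule.eq_bot_iff _).2 fun v _ => h0 v
  refine ⟨?_, ?_, ?_, ?_⟩
  · unfold fa; omega
  · unfold fb; omega
  · unfold fc; rw [hY, finrank_bot]
  · unfold fd; rw [hV, finrank_bot]; omega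

/-- **Proposition 2** as the hypotheses of Roy's Theorem 3 for `(𝒞, a, b, c, d, r)`.
[cite: Roy1992, §2 Proposition 2 (p. 28); §3 proof of Theorem 2bis (p. 32)] -/
theorem thm3Hyp (ω : K) : (𝒞).Thm3Hyp (fa ω : Obj F L → ℕ) fb fc fd fr where
  ha := fa_upperAdditive ω
  hb := fb_additive
  hc := fc_additive
  hd := fun _ _ _ hE => (fd_additive hE).ge
  hr := fr_additive
  vanish := vanish ω

/-! ### Proposition 3 -/

/-- **Proposition 3**: "For each object `X` of `𝒞`, there exists a cokernel `s : X → X'` with domain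
`X` such that `d₁(X') ≤ a(X)` and `b(X') = b(X)`" — `s = id × t₁` with `t₁` a rational surjection of
kernel `K·(V ∩ (0 × ℚ^{d₁}))`; then `d₁' = d₁ − dim_K(V ∩ (0 × ℚ^{d₁})) ≤ d₁ − dim_ℚ(Y ∩ Ω)` and
`ker(s) ⊂ V` (for `ω = 0`, `Ω = 0` and the bound is trivial). [cite: Roy1992, §2 Proposition 3 (pp. 28–29)] -/
theorem prop3 (ω : K) (X : Obj F L) :
    ∃ X', (𝒞).IsCoker X X' ∧ fd₁ X' ≤ fa ω X ∧ fb X' = fb X := by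
  -- `S₁` = the rational `q` with `(0, q) ∈ V`
  let ι : (Fin X.d₁ → ℚ) →ₗ[ℚ] LinTangent K X.d₀ X.d₁ :=
    ((LinearMap.inr K (Fin X.d₀ → K) (Fin X.d₁ → K)).restrictScalars ℚ) ∘ₗ incl ℚ K X.d₁
  have hι : ∀ q, ι q = (0, incl ℚ K X.d₁ q) := fun q => rfl
  let S₁ : Submodule ℚ (Fin X.d₁ → ℚ) := (X.V.restrictScalars ℚ).comap ι
  have hS₁ : ∀ q, q ∈ S₁ ↔ ((0 : Fin X.d₀ → K), incl ℚ K X.d₁ q) ∈ X.V := fun q => Iff.rfl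
  obtain ⟨d₁', A₁, hdim, hsurj₁, hker₁⟩ := exists_surjective_ker_eq_spanK (F := ℚ) (K := K) S₁
  -- `s = id × t₁`
  set s : LinTangent K X.d₀ X.d₁ →ₗ[K] LinTangent K X.d₀ d₁' :=
    ((1 : Matrix (Fin X.d₀) (Fin X.d₀) F).map (algebraMap F K)).mulVecLin.prodMap
      (A₁.map (algebraMap ℚ K)).mulVecLin with hs_def
  have hbr : IsBiRational F s := isBiRational_prodMap 1 A₁
  have hone : ((1 : Matrix (Fin X.d₀) (Fin X.d₀) F).map (algebraMap F K)).mulVecLin =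
      LinearMap.id := by
    rw [Matrix.map_one _ (map_zero _) (map_one _), Matrix.mulVecLin_one]
  have hs : IsAdmissible F s := by
    refine ⟨?_, hbr⟩
    rw [hs_def, hone, LinearMap.coe_prodMap]
    exact Function.surjective_id.prodMap hsurj₁
  have hker_s : LinearMap.ker s = (⊥ : Submodule K (Fin X.d₀ → K)).prod (spanK K S₁) := by
    rw [hs_def, LinearMap.ker_prodMap, hone, LinearMap.ker_id, hker₁]
  have hker_le : LinearMap.ker s ≤ X.V := by
    rw [hker_s]
    rintro ⟨x, y⟩ ⟨hx, hy⟩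
    change x ∈ (⊥ : Submodule K _) at hx
    rw [Submodule.mem_bot] at hx
    subst hx
    change y ∈ spanK K S₁ at hy
    have hle : (spanK K S₁).map (LinearMap.inr K (Fin X.d₀ → K) (Fin X.d₁ → K)) ≤ X.V := by
      rw [spanK, Submodule.map_span, Submodule.span_le]
      rintro _ ⟨_, ⟨q, hq, rfl⟩, rfl⟩
      exact (hS₁ q).1 hq
    exact hle ⟨y, hy, rfl⟩
  have hfinker : finrank K (LinearMap.ker s) = finrank ℚ S₁ := by
    rw [hker_s, finrank_prod_eq, finrank_bot, finrank_spanK, zero_add]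
  have hmap : finrank K (X.V.map s) + finrank K (LinearMap.ker s) = finrank K X.V := by
    rw [finrank_map_add_finrank_ker, sup_eq_left.2 hker_le]
  have hkerV : finrank K (LinearMap.ker s) ≤ finrank K X.V := Submodule.finrank_mono hker_le
  -- `dim_ℚ(Y ∩ Ω) ≤ dim_ℚ S₁`: trivial if `ω = 0`; else `Y ∩ Ω ⊆ Ω ∩ V = θ(S₁)`, `θ(q) = ω (0, q)`
  have hm : finrank ℚ ↥(X.Y ⊓ Omega ω X.d₀ X.d₁) ≤ finrank ℚ S₁ := by
    by_cases hω : ω = 0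
    · have hΩ : Omega ω X.d₀ X.d₁ = (⊥ : Submodule ℚ (LinTangent K X.d₀ X.d₁)) := by
        rw [Omega, Submodule.span_eq_bot]
        rintro _ ⟨j, rfl⟩
        simp [hω]
      rw [hΩ, inf_bot_eq, finrank_bot]
      exact Nat.zero_le _
    let θ : (Fin X.d₁ → ℚ) →ₗ[ℚ] LinTangent K X.d₀ X.d₁ := ω • ι
    have hθ : ∀ q, θ q = ω • ((0 : Fin X.d₀ → K), incl ℚ K X.d₁ q) := fun q => rfl
    have hle : X.Y ⊓ Omega ω X.d₀ X.d₁ ≤ S₁.map θ := by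
      rintro v ⟨hvY, hvΩ⟩
      obtain ⟨h1, h2⟩ := mem_omega_iff.1 hvΩ
      choose a ha using fun j => Submodule.mem_span_singleton.1 (h2 j)
      have hv : v = θ a := by
        ext k
        · simp [h1, hθ]
        · have e1 : (θ a).2 k = ω * algebraMap ℚ K (a k) := by simp [hθ]
          rw [e1, ← ha k, Algebra.smul_def, mul_comm]
      refine ⟨a, ?_, hv.symm⟩
      show ((0 : Fin X.d₀ → K), incl ℚ K X.d₁ a) ∈ X.V
      have : ((0 : Fin X.d₀ → K), incl ℚ K X.d₁ a) = ω⁻¹ • v := by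
        rw [hv, hθ, inv_smul_smul₀ hω]
      rw [this]
      exact X.V.smul_mem _ (X.hYV hvY)
    exact (LinearMap.finrank_le_finrank_of_injective (Submodule.inclusion_injective hle)).trans
      (Submodule.finrank_map_le θ S₁)
  refine ⟨X.mapObj s hbr, ⟨s, X.isCokerMap_mapObj hs⟩, ?_, ?_⟩
  · show d₁' ≤ X.d₁ - finrank ℚ ↥(X.Y ⊓ Omega ω X.d₀ X.d₁)
    omega
  · show X.d₀ + d₁' - finrank K (X.V.map s) = X.d₀ + X.d₁ - finrank K X.V
    omega

/-! ### Theorem 1bis -/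

/-- **Theorem 1bis**: Statement 1 of Roy's Theorem 3 holds for `(𝒞, a, b, c, d, r)` — it is
`Thm1 F L ω`. [cite: Roy1992, §2 Theorem 1bis (p. 27); §3 proof of Theorem 2bis (p. 32)] -/
theorem statement1_of_thm1 (h : Thm1 F L ω) : (𝒞).Statement1 (fa ω : Obj F L → ℕ) fb fc fd fr := by
  intro X hb
  obtain ⟨d₀', d₁', s, hs, hne, hineq⟩ := exists_mapObj_of_thm1 h X hb
  exact ⟨X.mapObj s hs.2, ⟨s, X.isCokerMap_mapObj hs⟩, hne, hineq⟩

end Obj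

end Literature.NumberTheory.Transcendental.RoyRank
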